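import Summits.CriticalPhenomena.PercolationContinuityZ3.Theorems.Transplant.FKConnectivityAllQForestAdjacentDenseSeparator
import Summits.CriticalPhenomena.PercolationContinuityZ3.Theorems.Transplant.FKConnectivityAllQForestAdjacentTriangleSeparator
import HarnessLib

/-!
# Gluing a side onto a configuration whose trace on a three-point separator has rank at most one

builds on p205010 (kernel theorem, internal audit signed; external expert review pending).  No definitions, no named facts, no sorries;
standard axioms.

Tools for the RESIDUAL analysis of the square-free adjacent forest node across a three-point separator `S = {a, b, c}` (memo
bschramm/FROM-fk-1-g20-SEPARATOR-EXCHANGE.md §3: one step below density every trace that occurs in a residual colouring is discrete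
or joins exactly one pair of `S`).  `U` is a configuration meeting the side `V₂` only inside `S` (a side together with gadget pairs),
`Z` a configuration with pairs on `V₂`.
* `trace_eq_single` — if `Z` joins `a` to `c` and neither `a, b` nor `b, c`, then `Z` has the same trace on `S` as the single pair `{ac}`.
* **`isForestCfg_union_of_rank_le_one`** — GLUING LEMMA: if `Z ∈ Fo` does not join `a, b`, and for each of the two other pairs `xy`
  that `Z` might join the configuration `U ∪ {xy}` is a forest, then `U ∪ Z ∈ Fo` (exchange `…ForestSeparatorExchange` against the
  canonical one-pair representative of the trace, or free gluing `isForestCfg_union_of_sep` when the trace is discrete).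
* `not_reachable_inter_of_mem` — a pair of a forest lying outside `E` is not doubled by a join inside `X ∩ E`.
[cite: Grimmett2006, §1.5 (p. 13); §3.8 (pp. 61–62); §4.2 Lemma (4.13)]
-/

noncomputable section

namespace Summit.CriticalPhenomena.PercolationContinuityZ3.Theorems

namespace FK

open Set SimpleGraph Literature.Probability.LatticeModels Literature.Probability.Percolation
open scoped Classical

variable {V : Type*} [Fintype V]

section GlueRankOne

variable {V₂ : Set V} {a b c : V}

omit [Fintype V] in
/-- **A rank-one trace is the trace of one pair**: if `Z` joins `a` to `c` but neither `a` to `b` nor `b` to `c`, then on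
`S = {a, b, c}` it has the same trace as the single pair `{ac}`. [cite: Grimmett2006, §1.5 (p. 13)] -/
theorem trace_eq_single (hab : a ≠ b) (hac : a ≠ c) (hbc : b ≠ c) {Z : BondConfig V}
    (hZac : (openGraph Z).Reachable a c) (hZab : ¬ (openGraph Z).Reachable a b) (hZbc : ¬ (openGraph Z).Reachable b c) :
    ∀ x ∈ ({a, b, c} : Set V), ∀ y' ∈ ({a, b, c} : Set V),
      (openGraph ({s(a, c)} : BondConfig V)).Reachable x y' ↔ (openGraph Z).Reachable x y' := by
  have rac : (openGraph ({s(a, c)} : BondConfig V)).Reachable a c := reachable_of_mem hac rfl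
  have nab : ¬ (openGraph ({s(a, c)} : BondConfig V)).Reachable a b := not_reachable_single (Or.inl rfl) hab.symm hbc
  have ncb : ¬ (openGraph ({s(a, c)} : BondConfig V)).Reachable c b := not_reachable_single (Or.inr rfl) hab.symm hbc
  intro x hx y' hy'
  simp only [mem_insert_iff, mem_singleton_iff] at hx hy'
  rcases hx with rfl | rfl | rfl <;> rcases hy' with rfl | rfl | rfl
  · exact ⟨fun _ => Reachable.refl _, fun _ => Reachable.refl _⟩
  · exact ⟨fun h => absurd h nab, fun h => absurd h hZab⟩
  · exact ⟨fun _ => hZac, fun _ => rac⟩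
  · exact ⟨fun h => absurd h.symm nab, fun h => absurd h.symm hZab⟩
  · exact ⟨fun _ => Reachable.refl _, fun _ => Reachable.refl _⟩
  · exact ⟨fun h => absurd h.symm ncb, fun h => absurd h hZbc⟩
  · exact ⟨fun _ => hZac.symm, fun _ => rac.symm⟩
  · exact ⟨fun h => absurd h ncb, fun h => absurd h.symm hZbc⟩
  · exact ⟨fun _ => Reachable.refl _, fun _ => Reachable.refl _⟩

/-- Exchange against the canonical pair: if `U ∪ {ac} ∈ Fo` and the forest `Z` (pairs on `V₂`, `U` meeting `V₂` only in `S`) has the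
trace of `{ac}` on `S`, then `U ∪ Z ∈ Fo`. [cite: Grimmett2006, §4.2 Lemma (4.13); §3.8 (pp. 61–62)] -/
theorem isForestCfg_union_of_trace_single (hab : a ≠ b) (hac : a ≠ c) (hbc : b ≠ c) {U Z : BondConfig V}
    (hU : ∀ e ∈ U, ∀ z ∈ e, z ∈ V₂ → z ∈ ({a, b, c} : Set V)) (hZ : ∀ e ∈ Z, ∀ z ∈ e, z ∈ V₂) (hUZ : Disjoint U Z)
    (hacU : s(a, c) ∉ U) (hUF : IsForestCfg (insert s(a, c) U)) (hZF : IsForestCfg Z)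
    (hZac : (openGraph Z).Reachable a c) (hZab : ¬ (openGraph Z).Reachable a b) (hZbc : ¬ (openGraph Z).Reachable b c) :
    IsForestCfg (U ∪ Z) := by
  have hU' : ∀ e ∈ U, ∀ z ∈ e, z ∈ {z : V | z ∈ V₂ → z ∈ ({a, b, c} : Set V)} := fun e he z hz => hU e he z hz
  have hP : ∀ e ∈ ({s(a, c)} : BondConfig V), ∀ z ∈ e, z ∈ {z : V | z ∈ V₂ → z ∈ ({a, b, c} : Set V)} → z ∈ ({a, b, c} : Set V) := by
    intro e he z hz _
    rw [mem_singleton_iff.1 he] at hz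
    rcases Sym2.mem_iff.1 hz with rfl | rfl
    · exact mem_insert _ _
    · exact mem_insert_of_mem _ (mem_insert_of_mem _ rfl)
  have hZ' : ∀ e ∈ Z, ∀ z ∈ e, z ∈ {z : V | z ∈ V₂ → z ∈ ({a, b, c} : Set V)} → z ∈ ({a, b, c} : Set V) :=
    fun e he z hz hzX => hzX (hZ e he z hz)
  have hF : IsForestCfg (U ∪ {s(a, c)}) := by rw [union_singleton]; exact hUF
  exact isForestCfg_union_exchange (W := ({a, b, c} : Set V)) hU' hP hZ' (trace_eq_single hab hac hbc hZac hZab hZbc)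
    (disjoint_singleton_right.2 hacU) hUZ hF hZF

/-- **Gluing lemma for a side of rank at most one.**  `U` meets `V₂` only in `S = {a, b, c}`, `Z ∈ Fo` has its pairs on `V₂` and none
inside `S`, `U ∩ Z = ∅`, `U ∈ Fo`, and `Z` does NOT join `a` to `b`.  If `U ∪ {ac} ∈ Fo` whenever `Z` joins `a, c`, and `U ∪ {bc} ∈ Fo`
whenever `Z` joins `b, c`, then `U ∪ Z ∈ Fo`: the trace of `Z` is discrete (free gluing) or a single pair (exchange against that pair).
[cite: Grimmett2006, §1.5 (p. 13); §3.8 (pp. 61–62); §4.2 Lemma (4.13)] -/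
theorem isForestCfg_union_of_rank_le_one (hab : a ≠ b) (hac : a ≠ c) (hbc : b ≠ c) {U Z : BondConfig V}
    (hU : ∀ e ∈ U, ∀ z ∈ e, z ∈ V₂ → z ∈ ({a, b, c} : Set V)) (hZ : ∀ e ∈ Z, ∀ z ∈ e, z ∈ V₂) (hUZ : Disjoint U Z)
    (hZab' : s(a, b) ∉ Z) (hZac' : s(a, c) ∉ Z) (hZbc' : s(b, c) ∉ Z) (hUF : IsForestCfg U) (hZF : IsForestCfg Z)
    (hnab : ¬ (openGraph Z).Reachable a b)
    (hcase_ac : (openGraph Z).Reachable a c → s(a, c) ∉ U ∧ IsForestCfg (insert s(a, c) U))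
    (hcase_bc : (openGraph Z).Reachable b c → s(b, c) ∉ U ∧ IsForestCfg (insert s(b, c) U)) :
    IsForestCfg (U ∪ Z) := by
  by_cases hZac : (openGraph Z).Reachable a c
  · by_cases hZbc : (openGraph Z).Reachable b c
    · exact absurd (hZac.trans hZbc.symm) hnab
    · obtain ⟨hacU, hF⟩ := hcase_ac hZac
      exact isForestCfg_union_of_trace_single hab hac hbc hU hZ hUZ hacU hF hZF hZac hnab hZbc
  · by_cases hZbc : (openGraph Z).Reachable b c
    · -- exchange against `{bc}`: relabel `(a, b, c) ↦ (b, a, c)`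
      obtain ⟨hbcU, hF⟩ := hcase_bc hZbc
      have hperm : ({b, a, c} : Set V) = {a, b, c} := (triple_perm a b c).1
      have hU' : ∀ e ∈ U, ∀ z ∈ e, z ∈ V₂ → z ∈ ({b, a, c} : Set V) := by rw [hperm]; exact hU
      exact isForestCfg_union_of_trace_single hab.symm hbc hac hU' hZ hUZ hbcU hF hZF hZbc (fun h => hnab h.symm) hZac
    · -- discrete trace: free gluing
      refine isForestCfg_union_of_sep hab hac hbc hU hZ hUZ hZab' hZac' hUF hZF fun x hx y' hy' hxy => ?_
      simp only [mem_insert_iff, mem_singleton_iff] at hx hy'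
      rcases hx with rfl | rfl | rfl <;> rcases hy' with rfl | rfl | rfl
      · rfl
      · exact absurd hxy hnab
      · exact absurd hxy hZac
      · exact absurd hxy.symm hnab
      · rfl
      · exact absurd hxy hZbc
      · exact absurd hxy.symm hZac
      · exact absurd hxy.symm hZbc
      · rfl

omit [Fintype V] in
/-- **A pair of a forest is not doubled inside a part avoiding it**: if `X ∈ Fo`, `s(x, y') ∈ X`, `s(x, y') ∉ E`, then `x, y'` are not
joined in `X ∩ E`. [cite: Grimmett2006, §1.5 (p. 13)] -/
theorem not_reachable_inter_of_mem {X : BondConfig V} {E : Set (Sym2 V)} {x y' : V} (hX : IsForestCfg X) (hne : x ≠ y')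
    (hg : s(x, y') ∈ X) (hgE : s(x, y') ∉ E) : ¬ (openGraph (X ∩ E)).Reachable x y' :=
  not_reachable_of_disjoint_join hX inter_subset_left (singleton_subset_iff.2 hg)
    (disjoint_singleton_right.2 fun h => hgE h.2) hne (reachable_of_mem hne rfl)

end GlueRankOne

end FK

end Summit.CriticalPhenomena.PercolationContinuityZ3.Theorems

end
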